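import Summits.ResolutionOfSingularities.ResolutionOfSingularities.Theorems.PurelyInseparableDim4ResConeTwoSlotTransport
import Summits.ResolutionOfSingularities.ResolutionOfSingularities.Theorems.PurelyInseparableDim4ResConeTwoSlotLedger
import Summits.ResolutionOfSingularities.ResolutionOfSingularities.Theorems.PurelyInseparableDim4ResConeTwoSlotBoundary
import Summits.ResolutionOfSingularities.ResolutionOfSingularities.Theorems.PurelyInseparableDim4ResConeTwoSlotSkeleton
import Summits.ResolutionOfSingularities.ResolutionOfSingularities.Theorems.PurelyInseparableDim4TschirnhausCanonicalFrame
import HarnessLib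
import HarnessLib.Audit.Tags

/-!
# Purely inseparable four-folds — THE TWO-SLOT A∞(T) TAIL IS EMPTY (no rotation, T-sector): assembly of K24a
# (cell `res-dim4-pi`, K2(p) lane, slice B brick K24a, part γ, file 2 of 2)

[OURS · counted 0 · cell `res-dim4-pi` · K2(p) lane (holder res-dim4-p-12 g3, «p-1 takes K24a» 2026-08-29
01:14Z); the game = res-dim4-idea-4 g3 (bus 00:38:54Z); seat res-dim4-p-1 g4 over the landed parts α
`…ResConeTwoSlotGame` / γ₀ `…ResConeTwoSlotSkeleton` (p-1 g3), β1 `…TschirnhausCanonicalFrame`, β3 `…ResConeTwoSlotLedger`,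
β4-S `…ResConeTwoSlotFramedStep` / `…ResConeTwoSlotTransport`, β5/β6 (p-1 g3), γ-boundary `…ResConeTwoSlotBoundary`.]
Nothing here proves K2(p)/K2(5), `NoIsolatedTrap p p` or resolution of singularities in dimension ≥ 4 / characteristic
`p`.  AI kernel work, weaker than expert review.

WHAT IS PROVED (`p = 5`, `d = 3`, `e_G ≡ 3`).  Along a witnessed isolated above-floor `Step0 5` chain with `x^{r₀} ∣ F₀`,
shade `3` and `e_G = 3` from `k₀` on, the TWO-SLOT configuration (T2) of K26b `light_tail_trichotomy` — an idle boundary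
letter `ν` from `k₁` on, the other boundary letters stretch-born — is contradictory PROVIDED (a) NO ROTATION: every
chart from `k₁` on is a boundary letter (`1 ≤ r_k (j k)`), and (b) T-SECTOR: at `k₁` the vertex form charges every free
letter (`r_{k₁} i = 0 ⇒ ℓ i ≠ 0`).  Route: K27a's weights (`satellite_light_of_powerCone` + K26a `light_weights`) ⇒
`r = e_A + e_B + e_ν` frozen, translations `β_k e_f`, T-sector for ever (`…TwoSlotBoundary`) ⇒ at every `k ≥ k₁ + 1` a
canonical jet frame `φ_k` of order `7` (β1) ⇒ between consecutive frames the slot step is a pure corner read by β5/β6,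
the chart law and D4 (`slot_step_readings`), with the ledger readings from β3 (`frame_reading_eq_zero_of_born`) ⇒ the
readings `s m a b c = coeff_{r + (a+1)e_A + (b+1)e_B + c e_ν} (clean τ_{φ} F)` at `k₁ + 1 + m` satisfy the seven instance
hypotheses of the two-slot game ⇒ γ₀ `no_twoSlot_tail_of_readings` (game ⇒ constant chart ⇒ free tail ⇒
`FreeTailProof.noIsolatedFreeTailAt_self`) ⇒ `False`.

* §1 **`slot_step_readings_chain`** — the one-step package `slot_step_readings` dressed on the chain at a stage `k`
  (the child is `c (k+1)`, the frame's `x_κ`-coefficient is the real translation by the direction equation, the ledger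
  readings come from the births of the two slot letters).
* §2 **`no_twoSlot_tail_five_of_slot`** — the statement above.  What it does NOT cover (declared gaps of K24a, named
  hypotheses here): (a) ROTATION steps `j k` = the free letter (β4-F: swap normalisation at the jet level), (b) the
  L-SECTOR `ℓ_{k₁} f = 0`.  K27a's `hT2` is this theorem once (a) and (b) are discharged.

[cite: CossartJannsenSaito2020, Thm. 3.14, Thm. 9.3] [cite: Hauser2010, §§F–G] bears_on: LADDER-RESOLUTION:D157-DOOR2
(res-dim4-pi · K2(p) · slice B · K24a-γ).  Supports stmt-ResolutionOfSingularities-16155 (helper).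
-/

set_option linter.dupNamespace false -- mandated namespace of this single-conjunct summit

noncomputable section

namespace Summit.ResolutionOfSingularities.ResolutionOfSingularities.Theorems.PIDim4

namespace ResCone

open MvPolynomial Finset FrameChange
open Literature.AlgebraicGeometry.Resolution
open Literature.AlgebraicGeometry.Resolution.CentreBlowup
open Literature.AlgebraicGeometry.Resolution.Hauser2010
open Literature.AlgebraicGeometry.Resolution.HauserPerlega2019

variable {K : Type} [Field K]

section Tail

variable [CharP K 5] [DecidableEq K]

/-! ## 1. The one-step package on the chain -/

/-- **THE ONE-STEP PACKAGE ON THE CHAIN** (K24a-β4-S dressed): at a stage `k ≥ k₀` of a power-cone stretch (frame data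
`ℓ, a0, λ`), with boundary `r = e_κ + e_o + e_ν` at `k` and `k + 1`, chart `j k = κ`, translation `b k = β·e_f`, T-sector
`ℓ_k f ≠ 0`, `F_k` clean, `ord₀ ≡ 6`, `e_G (k+1) = 3`, the slot letters `κ, o` born before `k`, and canonical frames `φ`
(at `k`, linear coefficient `−ℓ_k κ/ℓ_k f` at `x_κ`) and `ψ` (at `k + 1`), both straight and Tschirnhaus to order `7`:
the five LEGALITY vanishings of `clean (τ_φ F_k)`, the six-term FLAG of `clean (τ_ψ F_{k+1})`, and the three
RELABELING identities between them. [OURS] [cite: CossartJannsenSaito2020, Thm. 3.14] -/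
theorem slot_step_readings_chain {c : ℕ → State K} {j : ℕ → Fin 4} {b : ℕ → Fin 4 → K}
    (hc : ∀ k, IsIsolated 5 (c k).F ∧ Step0 5 (c k) (c (k + 1))) (hw : FreeTail.IsWitnessedChain 5 c j b)
    (hr0 : ∀ e ∈ (c 0).F.support, (c 0).r ≤ e) (hfloor : ∀ k, ordZero (c k).F ≠ (5 : ℕ)) {k₀ : ℕ}
    (hshade : ∀ k, k₀ ≤ k → (c k).shade = ((3 : ℕ) : ℕ∞))
    (hord : ∀ k, k₀ ≤ k → ordZero (c k).F = ((6 : ℕ) : ℕ∞)) {ℓ : ℕ → Fin 4 → K} {a0 lam : ℕ → K}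
    (hform : ∀ k, k₀ ≤ k → resForm (c k) = C (a0 k) * (∑ i, C (ℓ k i) * X i) ^ 3)
    (hdir : ∀ k, k₀ ≤ k → ℓ k (j k) + dotProduct (ℓ k) (b k) = 0) (hlam : ∀ k, k₀ ≤ k → lam k ≠ 0)
    (hprop : ∀ k, k₀ ≤ k → ∀ i, i ≠ j k → ℓ (k + 1) i = lam k * ℓ k i)
    (hcarry : ∀ k, k₀ ≤ k → ∃ i, i ≠ j k ∧ ℓ k i ≠ 0) {k : ℕ} (hk : k₀ ≤ k) {κ o ν f : Fin 4} (hκo : κ ≠ o)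
    (hκν : κ ≠ ν) (hκf : κ ≠ f) (hoν : o ≠ ν) (hof : o ≠ f) (hνf : ν ≠ f) {r : Fin 4 →₀ ℕ}
    (hr : r = Finsupp.single κ 1 + Finsupp.single o 1 + Finsupp.single ν 1) (hrk : (c k).r = r)
    (hrk' : (c (k + 1)).r = r) (hjk : j k = κ) (hb : b k = Pi.single f (b k f)) (hℓf : ℓ k f ≠ 0)
    (hclean : deletePthPowers 5 (c k).F = (c k).F) (he3' : Module.finrank K (resVertex (c (k + 1))) = 3)
    (hbornκ : ∃ t, k₀ ≤ t ∧ t < k ∧ j t = κ ∧ ∀ m, t < m → m < k → j m ≠ κ ∧ b m κ = 0)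
    (hborno : ∃ t, k₀ ≤ t ∧ t < k ∧ j t = o ∧ ∀ m, t < m → m < k → j m ≠ o ∧ b m o = 0)
    {φ : MvPolynomial (Fin 4) K} (hφ : f ∉ φ.vars) (h0φ : constantCoeff φ = 0)
    (hφκ : coeff (Finsupp.single κ 1) φ = -(ℓ k κ / ℓ k f))
    (hφ3 : homogeneousComponent 3 (tsch f φ ((c k).F.divMonomial (c k).r)) = C (a0 k * ℓ k f ^ 3) * X f ^ 3)
    (hφN : ∀ n : Fin 4 →₀ ℕ, n f = 2 → n.degree ≤ 9 → coeff n (tsch f φ ((c k).F.divMonomial (c k).r)) = 0)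
    {ψ : MvPolynomial (Fin 4) K} (hψ : f ∉ ψ.vars) (h0ψ : constantCoeff ψ = 0) {a' : K}
    (hψ3 : homogeneousComponent 3 (tsch f ψ ((c (k + 1)).F.divMonomial (c (k + 1)).r)) = C a' * X f ^ 3)
    (hψN : ∀ n : Fin 4 →₀ ℕ, n f = 2 → n.degree ≤ 9 →
      coeff n (tsch f ψ ((c (k + 1)).F.divMonomial (c (k + 1)).r)) = 0) :
    (coeff (r + (Finsupp.single κ 2 + Finsupp.single o 2)) (deletePthPowers 5 (tsch f φ (c k).F)) = 0 ∧
      coeff (r + (Finsupp.single κ 3 + Finsupp.single o 1)) (deletePthPowers 5 (tsch f φ (c k).F)) = 0 ∧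
      coeff (r + (Finsupp.single κ 2 + Finsupp.single o 1 + Finsupp.single ν 1))
        (deletePthPowers 5 (tsch f φ (c k).F)) = 0 ∧
      coeff (r + (Finsupp.single κ 4 + Finsupp.single o 1)) (deletePthPowers 5 (tsch f φ (c k).F)) = 0 ∧
      coeff (r + (Finsupp.single f 1 + Finsupp.single κ 2 + Finsupp.single o 1))
        (deletePthPowers 5 (tsch f φ (c k).F)) = 0) ∧
    (coeff (r + (Finsupp.single κ 1 + Finsupp.single o 3)) (deletePthPowers 5 (tsch f ψ (c (k + 1)).F)) ≠ 0 ∨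
      coeff (r + (Finsupp.single κ 2 + Finsupp.single o 2)) (deletePthPowers 5 (tsch f ψ (c (k + 1)).F)) ≠ 0 ∨
      coeff (r + (Finsupp.single κ 1 + Finsupp.single o 2 + Finsupp.single ν 1))
          (deletePthPowers 5 (tsch f ψ (c (k + 1)).F)) ≠ 0 ∨
      coeff (r + (Finsupp.single κ 2 + Finsupp.single o 3)) (deletePthPowers 5 (tsch f ψ (c (k + 1)).F)) ≠ 0 ∨
      coeff (r + (Finsupp.single κ 2 + Finsupp.single o 4)) (deletePthPowers 5 (tsch f ψ (c (k + 1)).F)) ≠ 0 ∨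
      coeff (r + (Finsupp.single f 1 + Finsupp.single κ 1 + Finsupp.single o 2))
          (deletePthPowers 5 (tsch f ψ (c (k + 1)).F)) ≠ 0) ∧
    (coeff (r + (Finsupp.single κ 2 + Finsupp.single o 3)) (deletePthPowers 5 (tsch f ψ (c (k + 1)).F)) =
        coeff (r + (Finsupp.single κ 2 + Finsupp.single o 3)) (deletePthPowers 5 (tsch f φ (c k).F)) ∧
      coeff (r + (Finsupp.single κ 2 + Finsupp.single o 2)) (deletePthPowers 5 (tsch f ψ (c (k + 1)).F)) =
        coeff (r + (Finsupp.single κ 3 + Finsupp.single o 2)) (deletePthPowers 5 (tsch f φ (c k).F)) ∧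
      coeff (r + (Finsupp.single κ 3 + Finsupp.single o 2)) (deletePthPowers 5 (tsch f ψ (c (k + 1)).F)) =
        coeff (r + (Finsupp.single κ 4 + Finsupp.single o 2)) (deletePthPowers 5 (tsch f φ (c k).F))) := by
  haveI : Fact (Nat.Prime 5) := ⟨by norm_num⟩
  subst hrk
  obtain ⟨tκ, htκ, htκk, hjκ, hkeptκ⟩ := hbornκ
  obtain ⟨tₒ, htₒ, htₒk, hjo, hkepto⟩ := hborno
  have hdivk := IsolatedBand.isolated_chain_forall_le hc hr0
  -- the real child is `c (k+1)`
  have hck : c (k + 1) = CentreBlowup.step 5 Finset.univ κ (Pi.single f (b k f)) (c k) := by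
    rw [(hw k).2.2.2.2, hjk, ← hb]
  -- the frame's linear coefficient is the real translation
  have hβ : b k f = -(ℓ k κ / ℓ k f) := by
    refine translation_eq_neg_div (hℓf) ?_
    have h := hdir k hk
    rw [hjk, hb] at h
    exact h
  have hφκ' : coeff (Finsupp.single κ 1) φ = b k f := by rw [hφκ, hβ]
  have ha0 : a0 k ≠ 0 := ne_zero_of_resForm_eq_C_mul (hord k hk) (hdivk k) (hform k hk)
  have ha : a0 k * ℓ k f ^ 3 ≠ 0 := mul_ne_zero ha0 (pow_ne_zero _ hℓf)
  have hrf : (c k).r f = 0 := by rw [hr]; simp [hκf, hof, hνf]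
  -- the ledger readings (β3)
  have hdivκ : ∀ m : Fin 4 →₀ ℕ, m κ = 0 → m f ≤ 1 → m.degree ≤ 5 →
      coeff ((c k).r + m) (deletePthPowers 5 (tsch f φ (c k).F)) = 0 := fun m hmκ hmf hm =>
    frame_reading_eq_zero_of_born 5 hc hw hr0 hfloor (by norm_num) hshade hform hdir hlam hprop hcarry hκo hκf hof
      hℓf hrf htκ htκk hjκ hkeptκ htₒ htₒk hjo hkepto hφ h0φ (N := 7) (fun n hnf hn => hφN n hnf (by omega))
      (by omega) (by omega) (Or.inl hmκ)
  -- the package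
  have hdiv' : ∀ e ∈ (CentreBlowup.step 5 Finset.univ κ (Pi.single f (b k f)) (c k)).F.support,
      (CentreBlowup.step 5 Finset.univ κ (Pi.single f (b k f)) (c k)).r ≤ e := by
    rw [← hck]; exact hdivk (k + 1)
  have ho' : ordZero (CentreBlowup.step 5 Finset.univ κ (Pi.single f (b k f)) (c k)).F = ((6 : ℕ) : ℕ∞) := by
    rw [← hck]; exact hord (k + 1) (by omega)
  have he3'' : Module.finrank K (resVertex (CentreBlowup.step 5 Finset.univ κ (Pi.single f (b k f)) (c k))) = 3 := by
    rw [← hck]; exact he3'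
  have hiso' : IsIsolated 5 (CentreBlowup.step 5 Finset.univ κ (Pi.single f (b k f)) (c k)).F := by
    rw [← hck]; exact (hc (k + 1)).1
  have hψ3' : homogeneousComponent 3 (tsch f ψ ((CentreBlowup.step 5 Finset.univ κ (Pi.single f (b k f)) (c k)).F.divMonomial
      (CentreBlowup.step 5 Finset.univ κ (Pi.single f (b k f)) (c k)).r)) = C a' * X f ^ 3 := by
    rw [← hck]; exact hψ3
  have hψN' : ∀ n : Fin 4 →₀ ℕ, n f = 2 → n.degree ≤ 7 + 2 →
      coeff n (tsch f ψ ((CentreBlowup.step 5 Finset.univ κ (Pi.single f (b k f)) (c k)).F.divMonomial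
        (CentreBlowup.step 5 Finset.univ κ (Pi.single f (b k f)) (c k)).r)) = 0 := by
    rw [← hck]; exact fun n hnf hn => hψN n hnf (by omega)
  obtain ⟨-, hleg, hflag, hrel⟩ := slot_step_readings hκo hκν hκf hoν hof hνf (s := c k) hr (hdivk k) (hord k hk)
    hclean hdiv' ho' he3'' hiso' hφ h0φ hφκ' ha hφ3 (le_refl 7) (fun n hnf hn => hφN n hnf (by omega)) hdivκ hψ h0ψ
    hψ3' hψN'
  rw [← hck] at hflag hrel
  exact ⟨hleg, hflag, hrel⟩

/-! ## 2. The two-slot tail is empty (no rotation, T-sector) -/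

/-- **NO TWO-SLOT A∞(T) TAIL WITHOUT ROTATION IN THE T-SECTOR** (K24a-γ; statement in the module docstring): the
(T2) configuration of the light `d = 3` tail at `p = 5` — idle boundary letter `ν`, the other boundary letters
stretch-born — with SLOT STEPS ONLY from `k₁` on and the vertex form charging every free letter at `k₁`, is
contradictory on a witnessed isolated above-floor `Step0 5` chain of shade `3`, `e_G = 3`. [OURS · idea-4's two-slot
game, kernel-checked modulo the rotation steps (β4-F) and the L-sector] [cite: CossartJannsenSaito2020, Thm. 3.14, Thm. 9.3] -/
theorem no_twoSlot_tail_five_of_slot {c : ℕ → State K} {j : ℕ → Fin 4} {b : ℕ → Fin 4 → K}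
    (hc : ∀ k, IsIsolated 5 (c k).F ∧ Step0 5 (c k) (c (k + 1))) (hw : FreeTail.IsWitnessedChain 5 c j b)
    (hr0 : ∀ e ∈ (c 0).F.support, (c 0).r ≤ e) (hfloor : ∀ k, ordZero (c k).F ≠ (5 : ℕ)) {k₀ : ℕ}
    (hshade : ∀ k, k₀ ≤ k → (c k).shade = ((3 : ℕ) : ℕ∞))
    (he3 : ∀ k, k₀ ≤ k → Module.finrank K (resVertex (c k)) = 3) {ν : Fin 4} {k₁ : ℕ} (hk₁ : k₀ ≤ k₁)
    (hidle : ∀ k, k₁ ≤ k → 1 ≤ (c k).r ν ∧ j k ≠ ν ∧ b k ν = 0)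
    (hborn : ∀ k, k₁ ≤ k → ∀ i, i ≠ ν → 1 ≤ (c k).r i →
      ∃ t, k₀ ≤ t ∧ t < k ∧ j t = i ∧ ∀ m, t < m → m < k → j m ≠ i ∧ b m i = 0)
    (hslot : ∀ k, k₁ ≤ k → 1 ≤ (c k).r (j k))
    (hT : ∀ ℓ : Fin 4 → K, (∀ w, w ∈ resVertex (c k₁) ↔ dotProduct ℓ w = 0) → ∀ i, (c k₁).r i = 0 → ℓ i ≠ 0) :
    False := by
  haveI : Fact (Nat.Prime 5) := ⟨by norm_num⟩
  have h3K : (3 : K) ≠ 0 := fun h =>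
    absurd ((CharP.cast_eq_zero_iff K 5 3).mp (by exact_mod_cast h)) (by norm_num)
  -- the frame data of the power-cone stretch
  obtain ⟨ℓ, a0, lam, hpkg⟩ := chain_powerCone_package 5 hc hw hr0 hfloor (by norm_num) hshade he3
  have hV : ∀ k, k₀ ≤ k → ∀ w, w ∈ resVertex (c k) ↔ dotProduct (ℓ k) w = 0 := fun k hk => (hpkg k hk).2.1
  have hform : ∀ k, k₀ ≤ k → resForm (c k) = C (a0 k) * (∑ i, C (ℓ k i) * X i) ^ 3 :=
    fun k hk => (hpkg k hk).2.2.1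
  have hdir : ∀ k, k₀ ≤ k → ℓ k (j k) + dotProduct (ℓ k) (b k) = 0 := fun k hk => (hpkg k hk).2.2.2.1
  have hlam : ∀ k, k₀ ≤ k → lam k ≠ 0 := fun k hk => (hpkg k hk).2.2.2.2.1
  have hprop : ∀ k, k₀ ≤ k → ∀ i, i ≠ j k → ℓ (k + 1) i = lam k * ℓ k i :=
    fun k hk => (hpkg k hk).2.2.2.2.2.1
  have hcarry : ∀ k, k₀ ≤ k → ∃ i, i ≠ j k ∧ ℓ k i ≠ 0 := fun k hk => (hpkg k hk).2.2.2.2.2.2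
  -- K27a's weights: free tail (✗ FT) or weights `≤ 1` with `|r| = 3`
  have hlight : ∀ k, k₀ ≤ k → FreeTail.IsSatellite j b k → ∀ oₖ oₖ₁ : ℕ,
      ordZero (c k).F = oₖ → ordZero (c (k + 1)).F = oₖ₁ → oₖ + oₖ₁ + 3 ≤ 15 := by
    intro k hk hsat oₖ oₖ₁ hoₖ hoₖ₁
    have h := satellite_light_of_powerCone 5 hc hw hr0 hfloor (by norm_num) (by norm_num) hshade hform hdir hlam
      hprop hcarry hk hsat hoₖ hoₖ₁
    omega
  have hfloor' : ∀ k, ordZero (c k).F ≠ 5 := fun k => by have h := hfloor k; exact_mod_cast h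
  have hFT : ∀ k₂, (∀ k, k₂ ≤ k → ¬ FreeTail.IsSatellite j b k) → False := fun k₂ hfree => by
    obtain ⟨k, hk⟩ := FreeTailProof.noIsolatedFreeTailAt_self 5 K c j b k₂ hw hfree
    exact hk (hc k).1
  rcases light_weights hc hw hfloor' hshade hlight with ⟨k₂, -, hfree⟩ | hwt
  · exact hFT k₂ hfree
  -- orders `6` and the frozen boundary
  have hord : ∀ k, k₀ ≤ k → ordZero (c k).F = ((6 : ℕ) : ℕ∞) := by
    intro k hk
    obtain ⟨o, ho, -, -, hod⟩ := chain_shade_nat 5 hc hfloor hshade hk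
    rw [ho, (hwt k hk).2] at *
    have : o = 6 := by omega
    rw [this]
  have hfrozen := boundary_frozen 5 hw (k₁ := k₁) (D := 3) (fun k hk => hord k (hk₁.trans hk))
    (fun k hk => (hwt k (hk₁.trans hk)).2) (fun k hk => (hwt k (hk₁.trans hk)).1) hslot
  obtain ⟨r, hrdef⟩ : ∃ r : Fin 4 →₀ ℕ, (c k₁).r = r := ⟨_, rfl⟩
  have hrk : ∀ k, k₁ ≤ k → (c k).r = r := fun k hk => (hfrozen k hk).1.trans hrdef
  have hbk : ∀ k, k₁ ≤ k → ∀ i, r i ≠ 0 → b k i = 0 := fun k hk i hi =>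
    (hfrozen k hk).2 i (by rw [hrdef]; exact hi)
  have hw1 : ∀ i, r i ≤ 1 := fun i => by rw [← hrdef]; exact (hwt k₁ hk₁).1 i
  have hrdeg : r.degree = 3 := by rw [← hrdef]; exact (hwt k₁ hk₁).2
  -- the four letters
  have hν1 : r ν = 1 := le_antisymm (hw1 ν) (by rw [← hrdef]; exact (hidle k₁ le_rfl).1)
  obtain ⟨A, B, f, hAB, hAν, hAf, hBν, hBf, hνf, hrABν⟩ := exists_slot_letters hw1 hrdeg hν1
  have hrf : r f = 0 := by rw [hrABν]; simp [hAf, hBf, hνf]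
  have hrA : r A = 1 := by rw [hrABν]; simp [hAB, hAν]
  have hrB : r B = 1 := by rw [hrABν]; simp [hAB.symm, hBν]
  have hslots : ∀ k, k₁ ≤ k → j k = A ∨ j k = B := fun k hk =>
    chart_mem_slots hAB hAν hAf hBν hBf hνf hrABν (by rw [← hrk k hk]; exact hslot k hk) (hidle k hk).2.1
  have hjf : ∀ k, k₁ ≤ k → j k ≠ f := fun k hk => by
    rcases hslots k hk with h | h
    · rw [h]; exact hAf
    · rw [h]; exact hBf
  have hbsingle : ∀ k, k₁ ≤ k → b k = Pi.single f (b k f) := fun k hk =>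
    translation_eq_single hAB hAν hAf hBν hBf hνf hrABν (hbk k hk)
  -- the T-sector persists
  have hℓf : ∀ k, k₁ ≤ k → ℓ k f ≠ 0 :=
    tSector_persists hk₁ hlam hprop hjf (hT (ℓ k₁) (hV k₁ hk₁) f (by rw [hrdef, hrf]))
  -- births of the slot letters at every stage
  have hbornA : ∀ k, k₁ ≤ k → ∃ t, k₀ ≤ t ∧ t < k ∧ j t = A ∧ ∀ m, t < m → m < k → j m ≠ A ∧ b m A = 0 :=
    fun k hk => hborn k hk A hAν (by rw [hrk k hk, hrA])
  have hbornB : ∀ k, k₁ ≤ k → ∃ t, k₀ ≤ t ∧ t < k ∧ j t = B ∧ ∀ m, t < m → m < k → j m ≠ B ∧ b m B = 0 :=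
    fun k hk => hborn k hk B hBν (by rw [hrk k hk, hrB])
  -- clean from `k₁ + 1` on
  set k₂ := k₁ + 1 with hk₂
  have hclean : ∀ k, k₂ ≤ k → deletePthPowers 5 (c k).F = (c k).F := by
    intro k hk
    obtain ⟨k', rfl⟩ : ∃ k', k = k' + 1 := ⟨k - 1, by omega⟩
    rw [(hw k').2.2.2.2]
    exact deletePthPowers_step_F 5 Finset.univ (j k') (b k') (c k')
  have hdivk := IsolatedBand.isolated_chain_forall_le hc hr0
  -- a canonical frame of order `7` at every stage `≥ k₁`
  have hframe : ∀ k, ∃ φ : MvPolynomial (Fin 4) K, k₁ ≤ k → constantCoeff φ = 0 ∧ f ∉ φ.vars ∧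
      (∀ i, i ≠ f → coeff (Finsupp.single i 1) φ = -(ℓ k i / ℓ k f)) ∧
      homogeneousComponent 3 (tsch f φ ((c k).F.divMonomial (c k).r)) = C (a0 k * ℓ k f ^ 3) * X f ^ 3 ∧
      ∀ n : Fin 4 →₀ ℕ, n f = 2 → n.degree ≤ 9 → coeff n (tsch f φ ((c k).F.divMonomial (c k).r)) = 0 := by
    intro k
    by_cases hk : k₁ ≤ k
    · have ha0 : a0 k ≠ 0 :=
        ne_zero_of_resForm_eq_C_mul (hord k (hk₁.trans hk)) (hdivk k) (hform k (hk₁.trans hk))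
      obtain ⟨φ, h0, hv, hlin, h3, hN⟩ := FrameChange.exists_canonical_frame_state f (d := 3) (by norm_num) h3K
        (hord k (hk₁.trans hk)) (hdivk k) (by rw [hrk k hk, hrdeg]) ha0 (hℓf k hk) (hform k (hk₁.trans hk)) 7
      exact ⟨φ, fun _ => ⟨h0, hv, hlin, h3, fun n hnf hn => hN n (by rw [hnf]) (by omega)⟩⟩
    · exact ⟨0, fun h => absurd h hk⟩
  choose Φ hΦ using hframe
  -- the readings
  set sR : ℕ → ℕ → ℕ → ℕ → K := fun m a b' c' =>
    coeff (r + (Finsupp.single A (a + 1) + Finsupp.single B (b' + 1) + Finsupp.single ν c'))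
      (deletePthPowers 5 (tsch f (Φ (k₂ + m)) (c (k₂ + m)).F)) with hsR
  set tR : ℕ → ℕ → ℕ → ℕ → K := fun m a b' c' =>
    coeff (r + (Finsupp.single f 1 + Finsupp.single A (a + 1) + Finsupp.single B (b' + 1) + Finsupp.single ν c'))
      (deletePthPowers 5 (tsch f (Φ (k₂ + m)) (c (k₂ + m)).F)) with htR
  -- the one-step package at `k₂ + m`, for an `A`-step and for a `B`-step
  have hk₂m : ∀ m, k₁ ≤ k₂ + m := fun m => by omega
  have PA := fun m (hjA : j (k₂ + m) = A) =>
    slot_step_readings_chain hc hw hr0 hfloor hshade hord hform hdir hlam hprop hcarry (k := k₂ + m)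
      (hk₁.trans (hk₂m m)) hAB hAν hAf hBν hBf hνf hrABν (hrk _ (hk₂m m)) (hrk _ (hk₂m (m + 1))) hjA
      (hbsingle _ (hk₂m m)) (hℓf _ (hk₂m m)) (hclean _ (Nat.le_add_right _ _)) (he3 _ (hk₁.trans (hk₂m (m + 1))))
      (hbornA _ (hk₂m m)) (hbornB _ (hk₂m m)) (hΦ _ (hk₂m m)).2.1 (hΦ _ (hk₂m m)).1
      ((hΦ _ (hk₂m m)).2.2.1 A hAf) (hΦ _ (hk₂m m)).2.2.2.1 (hΦ _ (hk₂m m)).2.2.2.2 (hΦ _ (hk₂m (m + 1))).2.1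
      (hΦ _ (hk₂m (m + 1))).1 (hΦ _ (hk₂m (m + 1))).2.2.2.1 (hΦ _ (hk₂m (m + 1))).2.2.2.2
  have hrBAν : r = Finsupp.single B 1 + Finsupp.single A 1 + Finsupp.single ν 1 := by
    rw [hrABν, add_comm (Finsupp.single A 1) (Finsupp.single B 1)]
  have hjB : ∀ m, ¬ j (k₂ + m) = A → j (k₂ + m) = B := fun m hjA => (hslots _ (hk₂m m)).resolve_left hjA
  have PB := fun m (hjA : ¬ j (k₂ + m) = A) =>
    slot_step_readings_chain hc hw hr0 hfloor hshade hord hform hdir hlam hprop hcarry (k := k₂ + m)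
      (hk₁.trans (hk₂m m)) hAB.symm hBν hBf hAν hAf hνf hrBAν (hrk _ (hk₂m m)) (hrk _ (hk₂m (m + 1))) (hjB m hjA)
      (hbsingle _ (hk₂m m)) (hℓf _ (hk₂m m)) (hclean _ (Nat.le_add_right _ _)) (he3 _ (hk₁.trans (hk₂m (m + 1))))
      (hbornB _ (hk₂m m)) (hbornA _ (hk₂m m)) (hΦ _ (hk₂m m)).2.1 (hΦ _ (hk₂m m)).1
      ((hΦ _ (hk₂m m)).2.2.1 B hBf) (hΦ _ (hk₂m m)).2.2.2.1 (hΦ _ (hk₂m m)).2.2.2.2 (hΦ _ (hk₂m (m + 1))).2.1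
      (hΦ _ (hk₂m (m + 1))).1 (hΦ _ (hk₂m (m + 1))).2.2.2.1 (hΦ _ (hk₂m (m + 1))).2.2.2.2
  -- the game, and the free-tail theorem
  refine no_twoSlot_tail_of_readings 5 hc hw (A := A) (B := B) (k₁ := k₂) (s := sR) (t := tR)
    (fun k hk => hslots k (by omega)) ?_ ?_ ?_ ?_ ?_ ?_
  · -- `hfix`: `x_A²x_B³` is fixed by an `A`-step
    intro m hL
    have h := (PA m hL).2.2.1
    simp only [hsR, Finsupp.single_zero, add_zero]
    exact h
  · -- `hmuA`: `x_A²x_B³ ↦ x_A²x_B²` under a `B`-step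
    intro m hL
    have h := (PB m hL).2.2.2.1
    simp only [hsR, Finsupp.single_zero, add_zero]
    rw [add_comm (Finsupp.single A 2) (Finsupp.single B 2), add_comm (Finsupp.single A 2) (Finsupp.single B 3)]
    exact h
  · -- `hmuB`: `x_A²x_B⁴ ↦ x_A²x_B³` under a `B`-step
    intro m hL
    have h := (PB m hL).2.2.2.2
    simp only [hsR, Finsupp.single_zero, add_zero]
    rw [add_comm (Finsupp.single A 2) (Finsupp.single B 3), add_comm (Finsupp.single A 2) (Finsupp.single B 4)]
    exact h
  · -- `hlegL`: `x_A²x_B²` vanishes at an `A`-step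
    intro m hL
    have h := (PA m hL).1.1
    simp only [hsR, Finsupp.single_zero, add_zero]
    exact h
  · -- `hlegM`: `x_Ax_B³, x_A²x_B², x_Ax_B²x_ν ∈ S₀` and `x_Ax_B² ∈ S₁` vanish at a `B`-step
    intro m hL
    obtain ⟨h1, h2, h3, -, h5⟩ := (PB m hL).1
    simp only [hsR, htR, Finsupp.single_zero, add_zero]
    refine ⟨?_, ?_, ?_, ?_⟩
    · rw [add_comm (Finsupp.single A 1) (Finsupp.single B 3)]; exact h2
    · rw [add_comm (Finsupp.single A 2) (Finsupp.single B 2)]; exact h1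
    · rw [add_comm (Finsupp.single A 1) (Finsupp.single B 2)]; exact h3
    · rw [add_assoc (Finsupp.single f 1) (Finsupp.single A 1) (Finsupp.single B 2),
        add_comm (Finsupp.single A 1) (Finsupp.single B 2),
        ← add_assoc (Finsupp.single f 1) (Finsupp.single B 2) (Finsupp.single A 1)]
      exact h5
  · -- `hflag`: the flag after an `A`-step
    intro m hL
    have h := (PA m hL).2.1
    simp only [hsR, htR, Finsupp.single_zero, add_zero]
    exact h

/-! ## 3. K27a's light `d = 3` tail, with (T2) discharged under the two residual hypotheses -/

/-- **THE LIGHT `d = 3` TAIL AT `p = 5` IS EMPTY GIVEN NO ROTATION AND THE T-SECTOR** (K27a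
`no_light_powerCone_tail_three_five_of` with its by-value hypothesis `hT2` discharged by `no_twoSlot_tail_five_of_slot`):
a witnessed isolated above-floor `Step0 5` chain with `x^{r₀} ∣ F₀` cannot have shade `3` and `e_G = 3` from `k₀` on, if
from `k₀` on every chart letter is a boundary letter (`1 ≤ r_k (j k)`: no rotation step) and the vertex form charges
every free letter (`r_k i = 0 ⇒ ℓ_k i ≠ 0`: T-sector).  (T1) free tail and (T3) triple regime are K27a's; (T2) is §2.
[OURS · conditional on the two named residual hypotheses] [cite: CossartJannsenSaito2020, Thm. 3.10(4), Thm. 3.14, Thm. 9.3] -/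
theorem no_light_powerCone_tail_three_five_of_slot {c : ℕ → State K} {j : ℕ → Fin 4} {b : ℕ → Fin 4 → K}
    (hc : ∀ k, IsIsolated 5 (c k).F ∧ Step0 5 (c k) (c (k + 1))) (hw : FreeTail.IsWitnessedChain 5 c j b)
    (hr0 : ∀ e ∈ (c 0).F.support, (c 0).r ≤ e) (hfloor : ∀ k, ordZero (c k).F ≠ (5 : ℕ)) {k₀ : ℕ}
    (hshade : ∀ k, k₀ ≤ k → (c k).shade = ((3 : ℕ) : ℕ∞))
    (he3 : ∀ k, k₀ ≤ k → Module.finrank K (resVertex (c k)) = 3)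
    (hslot : ∀ k, k₀ ≤ k → 1 ≤ (c k).r (j k))
    (hT : ∀ k, k₀ ≤ k → ∀ ℓ : Fin 4 → K, (∀ w, w ∈ resVertex (c k) ↔ dotProduct ℓ w = 0) →
      ∀ i, (c k).r i = 0 → ℓ i ≠ 0) : False :=
  no_light_powerCone_tail_three_five_of hc hw hr0 hfloor hshade he3 fun _ k₁ hk₁ hidle hborn =>
    no_twoSlot_tail_five_of_slot hc hw hr0 hfloor hshade he3 hk₁ hidle hborn (fun k hk => hslot k (hk₁.trans hk))
      (hT k₁ hk₁)

end Tail

end ResCone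

end Summit.ResolutionOfSingularities.ResolutionOfSingularities.Theorems.PIDim4

end
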